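import Summits.CriticalPhenomena.PercolationContinuityZ3.Theorems.PercNearOneGluingNoHeavyLowerTailAntipodalR1Adjacent
import HarnessLib

/-!
# The forcing lemma for Reimer certificates (ANTI₁): determined edges force the target

Support file for `stmt-CriticalPhenomena-4575` (memo `prim-gen-kcluster/KCLUSTER-gen73.md` §1.3, the
FORCING LEMMA of the Reimer route; `KCLUSTER-gen74.md` §2).  No definitions, no named facts, no sorries.
Vocabulary of `AntipodalR1` (`clus`, `tSet`, `rSet`).

A point `w` of a cylinder `Z(x₁,x₂)` (equal to `x₁` off the flip set `T₁`, to `x̄₂` on `T₂`) is known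
to be open on `D_O = (O(x₁) ∖ T₁) ∪ (K(x₂) ∩ T₂)` and closed on `D_K = (K(x₁) ∖ T₁) ∪ (O(x₂) ∩ T₂)`.
The memo's conditions (F1) `a ~ y` in `D_O`, (F2) `D_O ⊇` an `a–y` edge cut, (F3) `a ~ z` in `D_K`,
(F4) `D_K ⊇` an `a–z` edge cut say exactly that the colouring `d_O = 𝟙_{D_O}` has `y ∈ O_a(d_O) ∖ K_a(d_O)`
and `d_K = 𝟙_{D_K}` has `z ∈ O_a(d_K) ∖ K_a(d_K)` (an edge cut of determined edges is the complement of
the `false`-edges of the indicator).  The lemma is then monotonicity of clusters: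

* `clus_mono` — enlarging the set of `col`-edges enlarges `col`-clusters;
* `mem_rSet_of_dominated` — if `d_O ≤ w` and `d_K ≤ w̄` pointwise and `d_O ∈ {y ∈ O_a∖K_a}`,
  `d_K ∈ {z ∈ O_a∖K_a}`, then `w ∈ R(y,z)`;
* `cylinder_subset_rSet` — the cylinder form (F1)–(F4) ⟹ `Z(x₁,x₂) ⊆ R(y,z)`, which is hypothesis (F)
  of the certificate theorem (`ReimerCertificate.card_le_of_certificate`, companion file
  `…ReimerCertificate`) for the pair `(x₁,x₂)`.
-/

namespace Summit.CriticalPhenomena.PercolationContinuityZ3.Theorems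

namespace AntipodalR1

open Finset Relation

variable {V ι : Type*}

/-- **Monotonicity of clusters**: if every `col`-edge of `x` is a `col`-edge of `x'`, the `col`-cluster
of `a` in `x` is contained in that in `x'`. [this work] -/
theorem clus_mono {ends : ι → Sym2 V} {x x' : ι → Bool} {col : Bool} {a : V}
    (h : ∀ e, x e = col → x' e = col) : clus ends x col a ⊆ clus ends x' col a := by
  intro v hv
  rw [mem_clus] at hv ⊢
  induction hv with
  | refl => exact ReflTransGen.refl
  | tail _ huw ih =>
    obtain ⟨e, he, hends⟩ := huw
    exact ReflTransGen.tail ih ⟨e, h e he, hends⟩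

variable [Fintype ι] [DecidableEq ι]

/-- **Forcing by domination.**  Let `w` be a colouring, `dO` a colouring whose open (`true`) edges are
open in `w`, and `dK` a colouring whose open edges are closed in `w`.  If `y ∈ O_a(dO) ∖ K_a(dO)` and
`z ∈ O_a(dK) ∖ K_a(dK)`, then `w ∈ R(y,z)`: `y ∈ O_a(w) ∖ K_a(w)` and `z ∈ K_a(w) ∖ O_a(w)`. [this work] -/
theorem mem_rSet_of_dominated (ends : ι → Sym2 V) (a y z : V) {dO dK w : ι → Bool}
    (hO : ∀ e, dO e = true → w e = true) (hK : ∀ e, dK e = true → w e = false)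
    (hy : dO ∈ tSet ends a y) (hz : dK ∈ tSet ends a z) : w ∈ rSet ends a y z := by
  classical
  obtain ⟨hyO, hyK⟩ := (mem_filter.1 hy).2
  obtain ⟨hzO, hzK⟩ := (mem_filter.1 hz).2
  have hO' : ∀ e, w e = false → dO e = false := fun e he => by
    cases h : dO e
    · rfl
    · exact absurd (hO e h) (by simp [he])
  have hK' : ∀ e, dK e = true → (fun i => !w i) e = true := fun e he => by simp [hK e he]
  have hK'' : ∀ e, (fun i => !w i) e = false → dK e = false := fun e he => by
    cases h : dK e
    · rfl
    · have := hK e h; simp_all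
  refine mem_filter.2 ⟨mem_univ _, clus_mono hO hyO, fun h => hyK (clus_mono hO' h), ?_, ?_⟩
  · -- `z ∈ K_a(w)`: the open cluster of `dK` lies in the open cluster of `w̄`, the closed cluster of `w`
    have h1 : z ∈ clus ends (fun i => !w i) true a := clus_mono hK' hzO
    exact (mem_clus_flip ends w true a z).1 h1
  · -- `z ∉ O_a(w)`: the open cluster of `w` is the closed cluster of `w̄`, inside the closed cluster of `dK`
    intro h
    have h1 : z ∈ clus ends (fun i => !w i) false a := (mem_clus_flip ends w false a z).2 h
    exact hzK (clus_mono hK'' h1)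

/-- **The forcing lemma, cylinder form** (memo KCLUSTER-gen73 §1.3).  For colourings `x₁, x₂`, flip sets
`T₁, T₂` and a target `(y open-side, z closed-side)`, let `dO` mark the determined-open edges of the
cylinder `Z(x₁,x₂)` (`e ∉ T₁` open in `x₁`, or `e ∈ T₂` closed in `x₂`) and `dK` the determined-closed
ones (`e ∉ T₁` closed in `x₁`, or `e ∈ T₂` open in `x₂`).  If (F1,F2) `dO ∈ {y ∈ O_a∖K_a}` and (F3,F4)
`dK ∈ {z ∈ O_a∖K_a}`, then every point of the cylinder lies in `R(y,z)`. [this work] -/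
theorem cylinder_subset_rSet (ends : ι → Sym2 V) (a y z : V) (x₁ x₂ : ι → Bool) (T₁ T₂ : Finset ι)
    (hFO : (fun e => (decide (e ∉ T₁) && x₁ e) || (decide (e ∈ T₂) && !x₂ e)) ∈ tSet ends a y)
    (hFK : (fun e => (decide (e ∉ T₁) && !x₁ e) || (decide (e ∈ T₂) && x₂ e)) ∈ tSet ends a z)
    {w : ι → Bool} (hw₁ : ∀ i, i ∉ T₁ → w i = x₁ i) (hw₂ : ∀ i ∈ T₂, w i = !x₂ i) :
    w ∈ rSet ends a y z := by
  refine mem_rSet_of_dominated ends a y z (fun e he => ?_) (fun e he => ?_) hFO hFK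
  · simp only [Bool.or_eq_true, Bool.and_eq_true, decide_eq_true_eq] at he
    rcases he with ⟨h1, h2⟩ | ⟨h1, h2⟩
    · rw [hw₁ e h1]; exact h2
    · rw [hw₂ e h1]; simpa using h2
  · simp only [Bool.or_eq_true, Bool.and_eq_true, decide_eq_true_eq] at he
    rcases he with ⟨h1, h2⟩ | ⟨h1, h2⟩
    · rw [hw₁ e h1]; simpa using h2
    · rw [hw₂ e h1]; simpa using h2

end AntipodalR1

end Summit.CriticalPhenomena.PercolationContinuityZ3.Theorems
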